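import Mathlib
import Summits.Ventures.HodgeRepro2.T7SupportLocalFactorPositive

/-!
# Tier7/Line3/CompactTorusFactorBound — the finite factor at a place with COMPACT tori: `|b_v(γ)| ≤ vol`, `b_v(γ₀) ≠ 0`
(seat t7-x1, gen 2; the t7-lead's RESIDUAL MAP row U2, STATUS l. 15242)

LINE 3 (t7-plan-3), version (ii), the finite factors off the dominant term (`b_bound`, `b_γ₀` of p1's `DominantSide`,
row 674). At a finite place `v` where `E′_v / F_v` is a FIELD (inert or ramified — in particular the places of `S`
when inert, and every place `∤ N` of that kind) both tori `T_A(F_v), T_B(F_v) ≅ (E′_v)¹ × (E′_v)¹` are COMPACT, so the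
double-torus orbital integral of the characteristic function of a compact open `K_v` against unitary characters,
`b_v(γ) = ∫_{T_A × T_B} 1_{K_v}(t⁻¹ γ t′) μ_A(t) conj μ_B(t′) d(t, t′)`,
is an integral over a FINITE measure of a function of norm `≤ 1`; hence
* `|b_v(γ)| ≤ vol(T_A × T_B)` for EVERY `γ` (`norm_integral_le_volume`, `norm_orbital_le_volume`) — the upper half of
  row U2; the split place, where the tori are not compact, is x1's `SplitOrbitBox` p670387 (a box count);
* `b_v(γ₀) ≠ 0` when the support meets the orbit of `γ₀` in a non-empty open set on which the characters are trivial —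
  p1's `T7SupportLocalFactorPositive.integral_indicator_ne_zero` p664522, the lower half (cited, not restated);
* both halves in the shape of the `b_bound` field relative to `γ₀` with growth exponent `d′ = 0` — or any `d′ ≥ 0`
  (`b_bound_of_norm_le`): `‖b γ‖ ≤ (vol / ‖b γ₀‖) (1 + size γ)^{d′} ‖b γ₀‖`.
The answer to the lead's question («p1's LocalFactorPositive may already BE this row»): it is the LOWER half only;
the upper half is `norm_integral_le_of_norm_le_const` on the compact torus, typed here.

Nothing here is about a group, a character or an orbital integral beyond «an integral over a finite measure of a
function bounded by `1`»; the dictionary (which place is inert, what `K_v` is, that the tori are the compact groups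
`(E′_v)¹`) is in words (TYPING-CENSUS T7). Nothing about (N) or HC_CM; §8(d): NO.
Blind lane: Mathlib + the HodgeRepro2 prefix only; no sorry; axioms ⊆ {propext, Classical.choice, Quot.sound}.
-/

namespace Summit.Ventures.HodgeRepro2.Tier7.Line3.CompactTorusFactorBound

open MeasureTheory

variable {T : Type*} [MeasurableSpace T] (μ : Measure T) [IsFiniteMeasure μ]

/-- **an integral over a finite measure of a function of norm `≤ 1` is bounded by the total mass.** -/
theorem norm_integral_le_volume (φ : T → ℂ) (hφ : ∀ t, ‖φ t‖ ≤ 1) :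
    ‖∫ t, φ t ∂μ‖ ≤ μ.real Set.univ := by
  have h := norm_integral_le_of_norm_le_const (μ := μ) (f := φ) (C := 1) (Filter.Eventually.of_forall hφ)
  rw [one_mul] at h
  exact h

/-- the orbital-integral shape at a finite place: the indicator of the support `W` composed with the orbit map
`act` (`(t, t′) ↦ t⁻¹ γ t′`), times a unitary character `χ` (`(t, t′) ↦ μ_A(t) conj μ_B(t′)`) -/
noncomputable def orbital {X : Type*} (W : Set X) (act : T → X) (χ : T → ℂ) (t : T) : ℂ :=
  W.indicator (fun _ => (1 : ℂ)) (act t) * χ t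

omit [MeasurableSpace T] in
/-- the orbital integrand has norm `≤ 1` when the character is unitary. -/
theorem norm_orbital_le_one {X : Type*} (W : Set X) (act : T → X) (χ : T → ℂ) (hχ : ∀ t, ‖χ t‖ = 1) (t : T) :
    ‖orbital W act χ t‖ ≤ 1 := by
  classical
  unfold orbital
  rw [norm_mul, hχ t, mul_one, Set.indicator_apply]
  split_ifs <;> simp

/-- **the finite factor at a place with compact tori is bounded by the volume of the tori**, for every `γ`
(the orbit map and the support are arbitrary). -/
theorem norm_orbital_le_volume {X : Type*} (W : Set X) (act : T → X) (χ : T → ℂ) (hχ : ∀ t, ‖χ t‖ = 1) :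
    ‖∫ t, orbital W act χ t ∂μ‖ ≤ μ.real Set.univ :=
  norm_integral_le_volume μ _ (norm_orbital_le_one W act χ hχ)

/-- **the `b_bound` shape relative to `γ₀`** from a uniform bound `‖b γ‖ ≤ V` and `b γ₀ ≠ 0`: with any growth
exponent `d′ ≥ 0` and any non-negative size, `‖b γ‖ ≤ (V / ‖b γ₀‖) (1 + size γ)^{d′} ‖b γ₀‖`. -/
theorem b_bound_of_norm_le {Orb : Type*} (b : Orb → ℂ) (V : ℝ) (hb : ∀ γ, ‖b γ‖ ≤ V) (γ₀ : Orb)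
    (hγ₀ : b γ₀ ≠ 0) (size : Orb → ℝ) (hsize : ∀ γ, 0 ≤ size γ) {d' : ℝ} (hd' : 0 ≤ d') :
    ∀ γ, ‖b γ‖ ≤ (V / ‖b γ₀‖) * (1 + size γ) ^ d' * ‖b γ₀‖ := by
  intro γ
  have h0 : 0 < ‖b γ₀‖ := norm_pos_iff.2 hγ₀
  have h1 : 1 ≤ (1 + size γ) ^ d' := Real.one_le_rpow (by linarith [hsize γ]) hd'
  have hV : 0 ≤ V := (norm_nonneg _).trans (hb γ)
  calc ‖b γ‖ ≤ V := hb γ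
    _ = (V / ‖b γ₀‖) * 1 * ‖b γ₀‖ := by field_simp
    _ ≤ (V / ‖b γ₀‖) * (1 + size γ) ^ d' * ‖b γ₀‖ := by
        have hq : 0 ≤ V / ‖b γ₀‖ := div_nonneg hV h0.le
        gcongr

/-- **ROW U2, both halves at a place with compact tori**: the family of orbital integrals `b γ = ∫ orbital (W) (act γ) χ`
is bounded by the volume for every `γ`, and is non-zero at `γ₀` when the support of the integrand at `γ₀` contains a
non-empty open set of finite measure on which the integrand is `1` (p1's positivity row) — hence the `b_bound` shape
relative to `γ₀` with any `d′ ≥ 0`. -/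
theorem exists_b_bound_of_compact_tori [TopologicalSpace T] [OpensMeasurableSpace T] [μ.IsOpenPosMeasure]
    {X Orb : Type*} (W : Set X) (act : Orb → T → X) (χ : T → ℂ) (hχ : ∀ t, ‖χ t‖ = 1) (γ₀ : Orb)
    (U : Set T) (hU : IsOpen U) (hne : U.Nonempty) (hfin : μ U ≠ ⊤)
    (hγ₀ : ∫ t, orbital W (act γ₀) χ t ∂μ = ∫ t, U.indicator (fun _ => (1 : ℂ)) t ∂μ)
    (size : Orb → ℝ) (hsize : ∀ γ, 0 ≤ size γ) {d' : ℝ} (hd' : 0 ≤ d') :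
    (∫ t, orbital W (act γ₀) χ t ∂μ ≠ 0) ∧
    ∀ γ, ‖∫ t, orbital W (act γ) χ t ∂μ‖ ≤
      (μ.real Set.univ / ‖∫ t, orbital W (act γ₀) χ t ∂μ‖) * (1 + size γ) ^ d' *
        ‖∫ t, orbital W (act γ₀) χ t ∂μ‖ := by
  have hne0 : ∫ t, orbital W (act γ₀) χ t ∂μ ≠ 0 := by
    rw [hγ₀]
    exact T7SupportLocalFactorPositive.integral_indicator_ne_zero μ U hU hne hfin (fun _ => (1 : ℂ))
      (fun _ _ => rfl)
  refine ⟨hne0, ?_⟩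
  exact b_bound_of_norm_le (fun γ => ∫ t, orbital W (act γ) χ t ∂μ) (μ.real Set.univ)
    (fun γ => norm_orbital_le_volume μ W (act γ) χ hχ) γ₀ hne0 size hsize hd'

end Summit.Ventures.HodgeRepro2.Tier7.Line3.CompactTorusFactorBound
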